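import Literature.MathematicalPhysics.QuantumFieldTheory.Balaban1983to89.B4Thm19ZeroBoxHolder
import Literature.MathematicalPhysics.QuantumFieldTheory.Balaban1983to89.B4Cor23ZeroEta

/-!
# `Balaban1983to89.B4Ineq19ZeroBoxEta` — B4 «Theorem (Proposition 2.1 of [1])», clauses (1.9)–(1.10) IN THE CELL'S
# TYPED FORM `B4.Ineq19_110`, PROVED at `A = 0` on the ZERO-FIELD BOX FAMILY (every scale `k ≥ 1`, every box, every
# mass `m² ∈ [0, m²₊]`), read through b04's concrete `EtaSetting` carrier with the Hölder field in the printed BOND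
# convention; and the (1.9)–(1.10) half of the typed leaf `B4.ThmPrinted` for `0 ≤ α < 1` (`ThmPrinted19NN`) on that family

**Source.** T. Bałaban, *Regularity and Decay of Lattice Green's Functions*, Commun. Math. Phys. **89**, 571–597 (1983)
(bib key `Balaban1983RegularityDecay`, «B4» of the 1983–89 series): p. 572 [PDF 2] (1.1)–(1.6), p. 573 [PDF 3] the
Theorem with (1.9)–(1.12) and its last sentence on rectangular parallelepipeds (journal page = PDF page + 570; renders
`b2b-balaban-ref1/pages/1983-cmp89-regularity-decay/1983-cmp89-regularity-decay-p002-x2.png`, `-p003-x2.png`, read as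
images; cell transcript `b2b-balaban-b04/transcript-B4.md`).  A new leaf on top of `B4Thm19ZeroBoxHolder` (pv17 node 10:
the Hölder clause (1.9) at `A = 0` on boxes, `thm19_zero_box_holder_value_coeff`; through it `B4Thm110ZeroBoxDeriv`
node 7, `thm110_zero_box_deriv_value_coeff`, and `B4Thm110ZeroBox` node 6, `thm110_zero_box_value_coeff`) and of
`B4Cor23ZeroEta` (b04: the concrete zero-field carrier `ZeroFieldInstance` / `zeroFieldSettingB` of the cell's abstract
`B4.EtaSetting`, USED READ-ONLY).  The typed statements `B4.Ineq19_110`, `B4.ThmPrinted` are the cell's (`B4.lean`, b04)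
and are USED BY NAME, never restated.  No existing module is touched; nothing of B4 is asserted as a fact.

## WHAT IS PRINTED (verbatim; `≦` of the print written `≤`)

p. 572: «⟨φ, (−Δ^{η,N}_{A,Ω})φ⟩ = Σ_{b⊂Ω} η^d |(D^η_Aφ)(b)|² = Σ_{b⊂Ω} η^d |η^{−1}(U(A_b)φ(b₊) − φ(b₋))|²,   (1.3)» where the
«summation is over the set of all bonds b = ⟨b₋, b₊⟩ with end-points b₋, b₊ in Ω» […] «G_k(Ω, A) = (−Δ^{η,N}_{A,Ω} + m² +
aP_k(A))^{−1},   (1.6)  where m² ≥ 0 and a is a positive constant close to 1.»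

p. 573: «for an arbitrary pair of points x, x′ ∈ ηZ^d, let us denote by Γ_{x,x′} a shortest contour connecting these
points.» […] «**Theorem** (Proposition 2.1 of [1]). For α < 1 there exist positive constants δ₀, c₀, R₀ independent of
A, k, Ω and depending on d, M only, c₀ on α also, such that for e sufficiently small and for an arbitrary function
f : Ω → R^N, we have
|x − x′|^{−α} |U(A(Γ_{x,x′}))(D^η_{A,μ}G_k(Ω, A)f)(x′) − (D^η_{A,μ}G_k(Ω, A)f)(x)| ≤ c₀ exp(−δ₀ dist({x, x′}, supp f))‖f‖_∞   (1.9)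
for x, x′ ∈ Ω, and satisfying the condition dist({x, x′}, Ω^c) ≥ R₀. Similarly
|(D^η_{A,μ}G_k(Ω, A)f)(x)|, |(G_k(Ω, A)(x)| ≤ c₀ exp(−δ₀ dist(x, supp f))‖f‖_∞   (1.10)
for x ∈ Ω, dist(x, Ω^c) ≥ R₀.» ⟦sic: «(G_k(Ω, A)(x)» — read `(G_k(Ω, A)f)(x)`⟧ […] «For some simple sets Ω, e.g. for
rectangular parallelepipeds, the inequalities hold without any restrictions on the points x, x′, i.e. for all x, x′ ∈ Ω.»

## WHAT THIS FILE CERTIFIES (kernel-checked, zero `sorry`, no hypotheses; the lineage and b04's carrier are USED BY NAME)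

Fix a dimension `d + 1`, `L = ℓ + 1 ≥ 2`, the coefficient `a > 0` of `aP_k` in (1.6), a mass ceiling `m²₊`, a big-block
size `Mb` and a boundary-distance assignment `g` (the last two enter only the typed antecedent `bigBlocks` and the field
`bdistS`, neither of which (1.9)–(1.10) read).  The ZERO-FIELD BOX FAMILY `boxFam ℓ m²₊ a Mb g : BoxInst d ℓ m²₊ → EtaSetting`
(§2) has one member per scale `k ≥ 1` (mesh `η = L^{-k}`), box `Ω = Π_μ[0, M_μ)` of unit blocks (`M_μ ≥ 1`), block union
`Ω₀ ⊇ Ω`, mass `m² ∈ [0, m²₊]` and charge `e`; the member is b04's `ZeroFieldInstance` `⟨L^k, boxDom(L^k·M), R₀, m², e⟩`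
read by `zeroFieldSettingBond` (§1) = b04's `zeroFieldSettingB` with the two Hölder fields `lhs19`, `dlhs19` in the bond
convention (`holderQ`; every other field verbatim, `bond_fields_eq`, `bond_eq_update`).
* `ineq19_110_boxFam` (§5) — **THE CELL'S TYPED (1.9)–(1.10) `B4.Ineq19_110` AT `A = 0` ON EVERY BOX AT EVERY SCALE**:
  for every `0 ≤ α < 1` there are `δ₀ > 0`, `c₀ > 0` (depending on `d, ℓ, a, m²₊, α`; «independent of A, k, Ω») with
  `∀ R₀ i, Ineq19_110 (boxFam ℓ m²₊ a Mb g i) α δ₀ c₀ R₀` — i.e. (`ineq19_110_bond_iff`, by `Iff.rfl`) for every member,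
  direction `μ`, source `f` and points `x, x′` of the box:
  `|x − x′|_η^{−α}|(D_μG_k(Ω,0)f)(x′) − (D_μG_k(Ω,0)f)(x)| ≤ c₀e^{−δ₀dist_η({x,x′}, supp f)}‖f‖_∞` on pairs of bonds of `Ω`,
  `|(D_μG_k(Ω,0)f)(x)| ≤ c₀e^{−δ₀dist_η(x, supp f)}‖f‖_∞`, `|(G_k(Ω,0)f)(x)| ≤ c₀e^{−δ₀dist_η(x, supp f)}‖f‖_∞`, with NO
  restriction on the points (the typed antecedent `rect ∨ R₀ ≤ dist(·, Ωᶜ)` is not used; `rect` holds anyway,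
  `BoxInst.rect`);
* `lhs19_bound`, `valDG_bound`, `valG_bound` (§4) — the three clauses separately, each from the corresponding lineage
  theorem through the dictionary lemmas of §3 (`green_eq`: `G_k(Ω,0)` of the member IS `(boxOpR L^k a m² M)⁻¹` by
  `B4Lower18.fineOpR_boxDom`; `D1_le`/`D2_le`: the carrier's `η`-scaled set distance to `supp f` times `L^k` is below the
  lineage's lattice sup-distances; `edistR_rpow_neg`: `(η|x − x′|_∞)^{−α} = (L^k/|x′ − x|_∞)^α`; `fdiff_eq`; `transfer`:
  monotonicity in the constants);
* `ineq110_boxFamB` (§5) — the two (1.10) clauses hold VERBATIM in b04's own carrier `zeroFieldSettingB` (identical fields);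
* `ThmPrinted19NN` (§6) := the typed leaf `B4.ThmPrinted` with conclusion `Ineq19_110` only and `0 ≤ α < 1`
  (`thmPrinted19NN_of_thmPrinted`: the leaf implies it), and `thmPrinted19NN_boxFam` — **IT HOLDS ON THE BOX FAMILY**,
  with `R₀ = e₁ = 1` and the antecedents `regular`, `bigBlocks`, `0 < e ≤ e₁` unused;
* §7: NON-VACUITY — for every `e₁ > 0`, every `Mb ≥ 1` and EVERY scale `k ≥ 1` a member (the cube of one big block,
  `Ω₀ = Ω`, mass `0`, charge `e₁`) meets all four typed antecedents (`cube_hypotheses`), so the threshold «for e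
  sufficiently small» excludes no mesh; the index type is inhabited at `d + 1 = 4`, `L = 2`, `m²₊ = 1`.

## DICTIONARY (typist's; each line is a reading, not a quotation; everything at `A = 0`, `U ≡ 1`, one component; the
dictionaries of `B4Cor23ZeroEta` (carrier) and `B4Thm19ZeroBoxHolder` / `B4Thm110ZeroBox[Deriv]` (box theorems) apply)

* `Ω` a rectangular parallelepiped of unit blocks at mesh `η = L^{-k}` ↦ the member's fine point set
  `R = B4Reflection242.boxDom (L^k·M) = Π_μ[0, L^kM_μ) ∩ ℤ^{d+1}` (lattice units), `n = L^k`; `Ω₀ ⊇ Ω` ↦ any `R₀ ⊇ R`,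
  a union of `L^k`-blocks (inert for (1.9)–(1.10)).
* `G_k(Ω, 0)` ↦ b04's `ZeroFieldInstance.green a = (B4Lower18.fineOpR n a m² R)⁻¹`, `= (B4BoxCov237.boxOpR L^k a m² M)⁻¹`
  on the box (`green_eq`) — the operator of the lineage's theorems with the LITERAL coefficient `a` of (1.6).
* `D^η_{0,μ}ψ(x)` ↦ `B4Cor23Zero.fdiff n R μ ψ x = L^k(ψ(x + e_μ) − ψ(x))` on a bond `⟨x, x + ηe_μ⟩ ⊂ Ω` («end-points … in
  Ω», (1.3)), `0` if `x + e_μ ∉ Ω` (b04's Neumann reading: no bond, no derivative).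
* the left side of (1.9) ↦ `holderQ n R α μ ψ x x′` (§1): the printed quotient `|x − x′|_η^{−α}|D_μψ(x′) − D_μψ(x)|` when
  BOTH bonds `⟨x, x+ηe_μ⟩`, `⟨x′, x′+ηe_μ⟩` lie in `Ω`, and `0` otherwise — (1.9) compares covariant derivatives ON BONDS OF
  `Ω`; with a non-bond there is nothing to compare (OBSERVATION (O-bond) below for b04's unguarded field);
  `|x − x′|_η = B4Lower18.edistR n R x x′ = η·|x − x′|_∞` (sup norm; `x = x′` gives `0^{−α}·0 = 0` in Lean, the print's
  quotient being over `x ≠ x′`).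
* `dist({x,x′}, supp f)`, `dist(x, supp f)` ↦ b04's `sdist2`/`sdist1` = `B4Cor23ZeroDelta.setDist (edistR n R)` from
  `{x} ∪ {x′}` / `{x}` to `B4Cor23Zero.supp f` (`0` for `f = 0`, when both sides vanish anyway); `‖f‖_∞` ↦ b04's `supN`.
* «δ₀, c₀, R₀ independent of A, k, Ω and depending on d, M only, c₀ on α also […] for e sufficiently small» ↦ the typed
  leaf's `∀ α, … → ∃ δ₀ c₀ R₀ e₁ > 0, ∀ i, antecedents → …`; here `δ₀, c₀` depend on `d, ℓ, a, m²₊` and BOTH on `α`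
  (inherited from node 10), uniform in the member (`k`, the box, `Ω₀`, `m²`, `e`); `R₀`, `e₁` are free (boxes need no
  `R₀`; `A = 0` needs no threshold).
* `0 ≤ α < 1` ↦ the binders `(hα0 : 0 ≤ α) (hα1 : α < 1)` (OBSERVATION (O-α) below).

## OBSERVATIONS surfaced by the binding (analysis-level; NOT kernel-certified here; for b04 / the carver)

(O-α) The typed leaf `B4.ThmPrinted` quantifies `∀ α : ℝ, α < 1`, i.e. also over `α < 0`, where the weight
`|x − x′|^{−α} = |x − x′|^{|α|}` GROWS with the separation.  On any faithful family containing boxes of unbounded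
diameter (this one) the `α < 0` instances of (1.9) fail: with `x ∈ supp f` (right side `c₀‖f‖_∞`) and `x′` far away,
`(D_μG f)(x′) → 0` by (1.10) while `(D_μG f)(x)` stays of order `‖f‖_∞` for suitable `f`, so the left side is
unbounded.  The print's «α < 1» is the Hölder range of the norm (2.14) p. 577, `0 ≤ α < 1` (as certified in
`B4Green242Bridge` (2.36) and node 10); hence `ThmPrinted19NN` carries `0 ≤ α`, and the literal leaf is NOT claimed on
the family.  (A kernel refutation would need a uniform LOWER bound on `|D_μG_k(Ω,0)f(x)|`, which the lineage does not have.)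
(O-bond) b04's carrier fields `lhs19`/`dlhs19` form the quotient `|x − x′|_η^{−α}|fdiff(x′) − fdiff(x)|` UNGUARDED, with
`fdiff = 0` at a point whose `μ`-bond leaves `Ω`; at a face of `Ω` this pairs a genuine derivative with an artificial
`0` at `η`-distance `η`, weight `η^{−α}`.  For `G_k(Ω,0)` on a box this is presumably still bounded (the last-bond
derivative is `O(η^α‖f‖_∞)` by the reflection (2.42), `B4Reflection242` — true but not certified here); for
`δG_k(Ω,Ω₀,0)` at a face of `Ω` interior to `Ω₀` it is NOT: `D_μG_k(Ω₀,0)f̃` there is of order `‖f‖_∞` while the weight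
is `η^{−α} → ∞` (`k → ∞`, `α > 0`), and the typed antecedent `rect ∨ …` is met by `rect` — so the typed (1.11) with the
unguarded field fails on nested boxes although the printed (bond-convention) statement is not in doubt.  This file
therefore reads BOTH Hölder fields through `holderQ` (`zeroFieldSettingBond`); on pairs of bonds the two carriers agree
(`bond_lhs19_eq_of_bond`, `bond_dlhs19_eq_of_bond`), and every other field is b04's (`bond_fields_eq`).

## HONEST SCOPE — what is NOT certified here

(i) Only `A = 0` (`U ≡ 1`, `regular` void, the charge inert), one component.  (ii) Only boxes `Ω = Π_μ[0, M_μ)` of unit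
blocks placed at the origin (the `rect` branch of the typed antecedent; translated boxes are the same problem up to a
lattice translation, not formalised); general big-block unions `Ω` with the restriction `dist(·, Ω^c) ≥ R₀` (the print's
random-walk expansion (2.13), (2.18)–(2.22)) are NOT treated.  (iii) Only (1.9)–(1.10) = `Ineq19_110`; the `δG` clauses
(1.11)–(1.12) = `Ineq111_112` (second conjunct of the leaf) are NOT treated here (the lineage has them for nested boxes,
`B4Delta112ZeroBox[Holder]` nodes 9/11, in box coordinates; binding them needs the translation covariance of `fineOpR` —
a later node), so `B4.ThmPrinted` itself is not discharged (and by (O-α) cannot be, literally).  (iv) Mesh `η = L^{-k}`,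
`k ≥ 1`, `L ≥ 2` (the member type carries `k ≥ 1`; b04's carrier allows any `n ≥ 1`).  (v) Constants existential,
depending on `d, ℓ, a, m²₊, α`; distances are `η`-scaled sup-distances (Euclidean `≥` sup, so the printed Euclidean form
follows with `δ₀/√(d+1)`); `‖f‖_∞` over the fine points of `Ω`.  (vi) ROUTE: pure plumbing — the three lineage theorems
(print's box route pp. 582–584, kernel-proved there) instantiated on the member and transported through §3; no new
analysis.  (vii) This file does not touch `B4.lean`, `B4Cor23ZeroEta.lean` (b04's), `DagBinding`/`DagDischarged` (the
carver's); whether the binding's `B4.ThmPrinted` is re-typed (`0 ≤ α`, bond convention) is b04's call — this file only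
offers `ThmPrinted19NN` and the family.

**Value = kernel certificate (the cell's typed (1.9)–(1.10) at `A = 0` on the zero-field box family, all scales, all
`0 ≤ α < 1`, bound to b04's concrete carrier), NOT summit progress**: the Yang–Mills / `Summit.QuantumFields` statements
are untouched; no Literature fact is minted — every hypothesis used is kernel-proved in this package.
-/

namespace Literature.MathematicalPhysics.QuantumFieldTheory.Balaban1983to89.B4Ineq19ZeroBoxEta

open Finset Matrix
open Literature.MathematicalPhysics.QuantumFieldTheory.Balaban1983to89.B4 (EtaSetting Ineq19_110 Ineq111_112
  ThmPrinted)
open Literature.MathematicalPhysics.QuantumFieldTheory.Balaban1983to89.B4ContourShift (supNorm supNorm_nonneg)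
open Literature.MathematicalPhysics.QuantumFieldTheory.Balaban1983to89.B4Reflection242 (boxDom mem_boxDom)
open Literature.MathematicalPhysics.QuantumFieldTheory.Balaban1983to89.B4BoxCov237 (boxOpR uvec)
open Literature.MathematicalPhysics.QuantumFieldTheory.Balaban1983to89.B4Lower18 (fineOpR fineOpR_boxDom
  IsBlockUnion boxDom_isBlockUnion edistR)
open Literature.MathematicalPhysics.QuantumFieldTheory.Balaban1983to89.B4TwoRegion120 (supNorm_sub_comm)
open Literature.MathematicalPhysics.QuantumFieldTheory.Balaban1983to89.B4Cor23Zero (fdiff fdiff_of_mem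
  fdiff_of_not_mem supp l2n suppDist)
open Literature.MathematicalPhysics.QuantumFieldTheory.Balaban1983to89.B4Cor23ZeroDelta (setDist setDist_le dG
  mem_supp outR incl)
open Literature.MathematicalPhysics.QuantumFieldTheory.Balaban1983to89.B4Cor23ZeroEta (ZeroFieldInstance
  zeroFieldSettingB zeroFieldSetting)
open Literature.MathematicalPhysics.QuantumFieldTheory.Balaban1983to89.B4Thm110ZeroBox (thm110_zero_box_value_coeff)
open Literature.MathematicalPhysics.QuantumFieldTheory.Balaban1983to89.B4Thm110ZeroBoxDeriv
  (thm110_zero_box_deriv_value_coeff)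
open Literature.MathematicalPhysics.QuantumFieldTheory.Balaban1983to89.B4Thm19ZeroBoxHolder
  (thm19_zero_box_holder_value_coeff)

noncomputable section

variable {d : ℕ}

/-! ## §1 The Hölder quotient of (1.9) in the printed BOND convention -/

/-- **The left-hand side of (1.9) read on BONDS OF `Ω`** (p. 572 (1.3): the covariant derivative `D^η_{A,μ}` lives on
the bonds `⟨x, x + ηe_μ⟩` «with end-points … in Ω»): for a function `ψ` on the fine points of `Ω` (`= R`),
`|x − x′|_η^{−α}·|(D_μψ)(x′) − (D_μψ)(x)|` when BOTH `⟨x, x+e_μ⟩` and `⟨x′, x′+e_μ⟩` are bonds of `Ω`, and `0` otherwise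
(no Hölder quotient is formed with a non-bond).  `D_μ = B4Cor23Zero.fdiff` (`= η^{-1}(ψ(x+ηe_μ) − ψ(x))` on bonds),
`|·|_η = B4Lower18.edistR` (the `η`-scaled sup-distance), `U(A(Γ_{x,x′})) = 1` at `A = 0`.
[cite: Balaban1983RegularityDecay, (1.3) p.572 + (1.9) p.573, case A = 0, dictionary] -/
def holderQ (n : ℕ) (R : Finset (Fin (d + 1) → ℤ)) (α : ℝ) (μ : Fin (d + 1)) (ψ : ↥R → ℝ) (x x' : ↥R) : ℝ :=
  if x.1 + uvec μ ∈ R ∧ x'.1 + uvec μ ∈ R then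
    edistR n R x x' ^ (-α) * |fdiff n R μ ψ x' - fdiff n R μ ψ x|
  else 0

/-- `holderQ ≥ 0`. [folklore] -/
theorem holderQ_nonneg (n : ℕ) (R : Finset (Fin (d + 1) → ℤ)) (α : ℝ) (μ : Fin (d + 1)) (ψ : ↥R → ℝ)
    (x x' : ↥R) : 0 ≤ holderQ n R α μ ψ x x' := by
  unfold holderQ
  split_ifs
  · exact mul_nonneg (Real.rpow_nonneg (B4Cor23Zero.edistR_nonneg x x') _) (abs_nonneg _)
  · exact le_rfl

/-- off the bonds of `Ω` no quotient is formed. [folklore] -/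
theorem holderQ_of_not_bond {n : ℕ} {R : Finset (Fin (d + 1) → ℤ)} (α : ℝ) {μ : Fin (d + 1)} (ψ : ↥R → ℝ)
    {x x' : ↥R} (h : ¬(x.1 + uvec μ ∈ R ∧ x'.1 + uvec μ ∈ R)) : holderQ n R α μ ψ x x' = 0 := by
  rw [holderQ, if_neg h]

/-- on two bonds of `Ω` the quotient is the printed one. [folklore] -/
theorem holderQ_of_bond {n : ℕ} {R : Finset (Fin (d + 1) → ℤ)} (α : ℝ) {μ : Fin (d + 1)} (ψ : ↥R → ℝ)
    {x x' : ↥R} (hx : x.1 + uvec μ ∈ R) (hx' : x'.1 + uvec μ ∈ R) :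
    holderQ n R α μ ψ x x' = edistR n R x x' ^ (-α) * |fdiff n R μ ψ x' - fdiff n R μ ψ x| := by
  rw [holderQ, if_pos ⟨hx, hx'⟩]

/-- **THE ZERO-FIELD CARRIER WITH THE BOND-CONVENTION HÖLDER FIELDS**: the cell's concrete carrier
`B4Cor23ZeroEta.zeroFieldSettingB a M g i` (b04) with its two Hölder fields `lhs19` (for `G_k(Ω,0)f`) and `dlhs19` (for
`δG_k(Ω,Ω₀,0)f`) re-read through `holderQ`; EVERY OTHER FIELD IS b04's VERBATIM (`Site = R`, `green = (fineOpR n a m² R)⁻¹`,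
`valG/valDG/dvalG/dvalDG`, `sdist1/2`, `bdist1/2`, `bdistS = g i`, `supNorm = supN`, `rect`, `regular`, `bigBlocks`, `e = i.e`,
the pairings …).  See the module docstring, OBSERVATION (O-bond), for why the Hölder fields are re-read.
[cite: Balaban1983RegularityDecay, §1 pp. 572–573, case A = 0, dictionary] -/
def zeroFieldSettingBond (a : ℝ) (M : ℕ) (g : ∀ i : ZeroFieldInstance d, (↥i.R → ℝ) → ℝ)
    (i : ZeroFieldInstance d) : EtaSetting where
  Site := ↥i.R
  Dir := Fin (d + 1)
  Src := ↥i.R → ℝ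
  e := i.e
  regular := True
  bigBlocks := IsBlockUnion (M * i.n) i.R ∧ IsBlockUnion (M * i.n) i.R₀
  rect := ∃ l u : Fin (d + 1) → ℤ, ∀ x : Fin (d + 1) → ℤ, x ∈ i.R ↔ ∀ j, l j ≤ x j ∧ x j ≤ u j
  pdist := fun x y => edistR i.n i.R x y
  sdist1 := fun x f => setDist (edistR i.n i.R) {x} (supp f)
  sdist2 := fun x x' f => setDist (edistR i.n i.R) ({x} ∪ {x'}) (supp f)
  bdist1 := fun x => setDist (edistR i.n i.R₀) {incl i.hsub x} (outR i.R i.R₀)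
  bdist2 := fun x x' => setDist (edistR i.n i.R₀) ({incl i.hsub x} ∪ {incl i.hsub x'}) (outR i.R i.R₀)
  bdistS := fun f => g i f
  supNorm := fun f => i.supN f
  l2Norm := fun f => l2n f
  ssdist := fun f f' => suppDist i.n i.R f f'
  lhs19 := fun α μ f x x' => holderQ i.n i.R α μ ((i.green a).mulVec f) x x'
  valDG := fun μ f x => |fdiff i.n i.R μ ((i.green a).mulVec f) x|
  valG := fun f x => |(i.green a).mulVec f x|
  dlhs19 := fun α μ f x x' => holderQ i.n i.R α μ (dG i.n a i.m2 i.hsub f) x x'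
  dvalDG := fun μ f x => |fdiff i.n i.R μ (dG i.n a i.m2 i.hsub f) x|
  dvalG := fun f x => |dG i.n a i.m2 i.hsub f x|
  lower18 := fun γ => ∀ v : ↥i.R → ℝ, γ * (v ⬝ᵥ v) ≤ v ⬝ᵥ (fineOpR i.n a 0 i.R).mulVec v
  pair := fun k μ ν f f' => i.pairing a k μ ν f f'
  dpair := fun k μ ν f f' => i.dpairing a k μ ν f f'

/-- the default boundary-distance assignment `g = bdist` (as `B4Cor23ZeroEta.zeroFieldSetting`). [folklore] -/
def zeroFieldSettingBondStd (a : ℝ) (M : ℕ) : ZeroFieldInstance d → EtaSetting :=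
  zeroFieldSettingBond a M fun i f => B4Cor23ZeroDelta.bdist i.n i.hsub f

section CarrierFacts

variable (a : ℝ) (M : ℕ) (g : ∀ i : ZeroFieldInstance d, (↥i.R → ℝ) → ℝ) (i : ZeroFieldInstance d)

/-- the re-read carrier and b04's carrier have the same sites, directions, sources, (1.10)-fields, distances, norms,
predicates and pairings (everything except `lhs19`, `dlhs19`) — definitionally. [folklore] -/
theorem bond_fields_eq :
    (zeroFieldSettingBond a M g i).valG = (zeroFieldSettingB a M g i).valG ∧
    (zeroFieldSettingBond a M g i).valDG = (zeroFieldSettingB a M g i).valDG ∧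
    (zeroFieldSettingBond a M g i).dvalG = (zeroFieldSettingB a M g i).dvalG ∧
    (zeroFieldSettingBond a M g i).dvalDG = (zeroFieldSettingB a M g i).dvalDG ∧
    (zeroFieldSettingBond a M g i).sdist1 = (zeroFieldSettingB a M g i).sdist1 ∧
    (zeroFieldSettingBond a M g i).sdist2 = (zeroFieldSettingB a M g i).sdist2 ∧
    (zeroFieldSettingBond a M g i).bdist1 = (zeroFieldSettingB a M g i).bdist1 ∧
    (zeroFieldSettingBond a M g i).bdist2 = (zeroFieldSettingB a M g i).bdist2 ∧
    (zeroFieldSettingBond a M g i).bdistS = (zeroFieldSettingB a M g i).bdistS ∧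
    (zeroFieldSettingBond a M g i).supNorm = (zeroFieldSettingB a M g i).supNorm ∧
    (zeroFieldSettingBond a M g i).e = (zeroFieldSettingB a M g i).e ∧
    ((zeroFieldSettingBond a M g i).rect ↔ (zeroFieldSettingB a M g i).rect) ∧
    ((zeroFieldSettingBond a M g i).regular ↔ (zeroFieldSettingB a M g i).regular) ∧
    ((zeroFieldSettingBond a M g i).bigBlocks ↔ (zeroFieldSettingB a M g i).bigBlocks) ∧
    (zeroFieldSettingBond a M g i).pdist = (zeroFieldSettingB a M g i).pdist ∧
    (zeroFieldSettingBond a M g i).l2Norm = (zeroFieldSettingB a M g i).l2Norm ∧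
    (zeroFieldSettingBond a M g i).ssdist = (zeroFieldSettingB a M g i).ssdist ∧
    (zeroFieldSettingBond a M g i).lower18 = (zeroFieldSettingB a M g i).lower18 ∧
    (zeroFieldSettingBond a M g i).pair = (zeroFieldSettingB a M g i).pair ∧
    (zeroFieldSettingBond a M g i).dpair = (zeroFieldSettingB a M g i).dpair :=
  ⟨rfl, rfl, rfl, rfl, rfl, rfl, rfl, rfl, rfl, rfl, rfl, Iff.rfl, Iff.rfl, Iff.rfl, rfl, rfl, rfl, rfl, rfl, rfl⟩

/-- equivalently: the re-read carrier IS b04's carrier with the two Hölder fields replaced. [folklore] -/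
theorem bond_eq_update :
    zeroFieldSettingBond a M g i =
      { zeroFieldSettingB a M g i with
        lhs19 := fun α μ f x x' => holderQ i.n i.R α μ ((i.green a).mulVec f) x x'
        dlhs19 := fun α μ f x x' => holderQ i.n i.R α μ (dG i.n a i.m2 i.hsub f) x x' } :=
  rfl

/-- the Hölder field of the re-read carrier. [folklore] -/
theorem bond_lhs19 (α : ℝ) (μ : Fin (d + 1)) (f : ↥i.R → ℝ) (x x' : ↥i.R) :
    (zeroFieldSettingBond a M g i).lhs19 α μ f x x' = holderQ i.n i.R α μ ((i.green a).mulVec f) x x' := rfl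

/-- the `δG` Hölder field of the re-read carrier. [folklore] -/
theorem bond_dlhs19 (α : ℝ) (μ : Fin (d + 1)) (f : ↥i.R → ℝ) (x x' : ↥i.R) :
    (zeroFieldSettingBond a M g i).dlhs19 α μ f x x' = holderQ i.n i.R α μ (dG i.n a i.m2 i.hsub f) x x' := rfl

/-- on two bonds of `Ω` the re-read Hölder field IS b04's field (the two carriers differ only where b04's field pairs
a bond with a non-bond). [folklore] -/
theorem bond_lhs19_eq_of_bond (α : ℝ) {μ : Fin (d + 1)} (f : ↥i.R → ℝ) {x x' : ↥i.R}
    (hx : x.1 + uvec μ ∈ i.R) (hx' : x'.1 + uvec μ ∈ i.R) :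
    (zeroFieldSettingBond a M g i).lhs19 α μ f x x' = (zeroFieldSettingB a M g i).lhs19 α μ f x x' := by
  rw [bond_lhs19, holderQ_of_bond α _ hx hx']
  rfl

/-- the same for the `δG` Hölder field. [folklore] -/
theorem bond_dlhs19_eq_of_bond (α : ℝ) {μ : Fin (d + 1)} (f : ↥i.R → ℝ) {x x' : ↥i.R}
    (hx : x.1 + uvec μ ∈ i.R) (hx' : x'.1 + uvec μ ∈ i.R) :
    (zeroFieldSettingBond a M g i).dlhs19 α μ f x x' = (zeroFieldSettingB a M g i).dlhs19 α μ f x x' := by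
  rw [bond_dlhs19, holderQ_of_bond α _ hx hx']
  rfl

/-- **`B4.Ineq19_110` READ ON THE RE-READ CARRIER, UNFOLDED** (by `Iff.rfl`): the typed (1.9)–(1.10) of instance `i`
say — for all `μ, f, x, x′` meeting the typed antecedent — `holderQ ≤ c₀e^{−δ₀dist_η({x,x′},supp f)}‖f‖_∞`,
`|D_μG f(x)| ≤ c₀e^{−δ₀dist_η(x,supp f)}‖f‖_∞` and `|G f(x)| ≤ c₀e^{−δ₀dist_η(x,supp f)}‖f‖_∞` with `G = G_k(Ω,0) = i.green a`.
[cite: Balaban1983RegularityDecay, Theorem p. 573 (1.9)–(1.10), case A = 0, dictionary] -/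
theorem ineq19_110_bond_iff (α δ₀ c₀ R₀ : ℝ) :
    Ineq19_110 (zeroFieldSettingBond a M g i) α δ₀ c₀ R₀ ↔
      (∀ (μ : Fin (d + 1)) (f : ↥i.R → ℝ) (x x' : ↥i.R),
          ((zeroFieldSettingBond a M g i).rect ∨ R₀ ≤ (zeroFieldSettingBond a M g i).bdist2 x x') →
          holderQ i.n i.R α μ ((i.green a).mulVec f) x x' ≤
            c₀ * Real.exp (-(δ₀ * setDist (edistR i.n i.R) ({x} ∪ {x'}) (supp f))) * i.supN f) ∧
      (∀ (μ : Fin (d + 1)) (f : ↥i.R → ℝ) (x : ↥i.R),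
          ((zeroFieldSettingBond a M g i).rect ∨ R₀ ≤ (zeroFieldSettingBond a M g i).bdist1 x) →
          |fdiff i.n i.R μ ((i.green a).mulVec f) x| ≤
              c₀ * Real.exp (-(δ₀ * setDist (edistR i.n i.R) {x} (supp f))) * i.supN f ∧
            |(i.green a).mulVec f x| ≤
              c₀ * Real.exp (-(δ₀ * setDist (edistR i.n i.R) {x} (supp f))) * i.supN f) :=
  Iff.rfl

/-- the same unfolding for b04's verbatim carrier (its `lhs19` is the unguarded quotient). [folklore] -/
theorem ineq19_110_B_iff (α δ₀ c₀ R₀ : ℝ) :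
    Ineq19_110 (zeroFieldSettingB a M g i) α δ₀ c₀ R₀ ↔
      (∀ (μ : Fin (d + 1)) (f : ↥i.R → ℝ) (x x' : ↥i.R),
          ((zeroFieldSettingB a M g i).rect ∨ R₀ ≤ (zeroFieldSettingB a M g i).bdist2 x x') →
          edistR i.n i.R x x' ^ (-α) *
              |fdiff i.n i.R μ ((i.green a).mulVec f) x' - fdiff i.n i.R μ ((i.green a).mulVec f) x| ≤
            c₀ * Real.exp (-(δ₀ * setDist (edistR i.n i.R) ({x} ∪ {x'}) (supp f))) * i.supN f) ∧
      (∀ (μ : Fin (d + 1)) (f : ↥i.R → ℝ) (x : ↥i.R),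
          ((zeroFieldSettingB a M g i).rect ∨ R₀ ≤ (zeroFieldSettingB a M g i).bdist1 x) →
          |fdiff i.n i.R μ ((i.green a).mulVec f) x| ≤
              c₀ * Real.exp (-(δ₀ * setDist (edistR i.n i.R) {x} (supp f))) * i.supN f ∧
            |(i.green a).mulVec f x| ≤
              c₀ * Real.exp (-(δ₀ * setDist (edistR i.n i.R) {x} (supp f))) * i.supN f) :=
  Iff.rfl

/-- `|f(x)| ≤ ‖f‖_∞` (`ZeroFieldInstance.supN`). [folklore] -/
theorem abs_le_supN (f : ↥i.R → ℝ) (x : ↥i.R) : |f x| ≤ i.supN f := by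
  unfold ZeroFieldInstance.supN
  have h : (Finset.univ : Finset ↥i.R).Nonempty := ⟨x, Finset.mem_univ _⟩
  rw [dif_pos h]
  exact Finset.le_sup' (fun y => |f y|) (Finset.mem_univ x)

/-- `0 ≤ ‖f‖_∞`. [folklore] -/
theorem supN_nonneg (f : ↥i.R → ℝ) : 0 ≤ i.supN f := by
  unfold ZeroFieldInstance.supN
  split_ifs with h
  · obtain ⟨x, hx⟩ := h
    exact (abs_nonneg (f x)).trans (Finset.le_sup' (fun y => |f y|) hx)
  · exact le_rfl

end CarrierFacts

/-! ## §2 The zero-field BOX FAMILY (an index type and its map to b04's `ZeroFieldInstance`) -/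

/-- **One member of the zero-field box family** (for fixed `d`, `L = ℓ + 1` and the mass window `[0, m²₊]`): a
scale `k ≥ 1` (mesh `η = L^{-k}`), a box `Ω = Π_μ[0, M_μ)` of unit blocks (`M_μ ≥ 1`; fine points
`boxDom (L^k·M)`), ANY finite union `Ω₀ ⊇ Ω` of blocks (fine points `R₀`, a union of `L^k`-blocks — it enters only the
`δG` clauses, not (1.9)–(1.10)), a mass `m² ∈ [0, m²₊]`, and the charge coordinate `e` (inert at `A = 0`; it makes the
typed threshold «for e sufficiently small» non-vacuous, pattern of `B4Cor23ZeroEta` v1.1).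
[cite: Balaban1983RegularityDecay, §1 pp. 572–573, case A = 0] -/
structure BoxInst (d ℓ : ℕ) (m2plus : ℝ) where
  /-- the scale: `η = L^{-k}` -/
  k : ℕ
  hk : 1 ≤ k
  /-- the box `Π_μ [0, M_μ)` in unit-block units -/
  M : Fin (d + 1) → ℕ
  hM : ∀ i, 1 ≤ M i
  /-- the fine points of `Ω₀ ⊇ Ω` -/
  R₀ : Finset (Fin (d + 1) → ℤ)
  hR₀ : IsBlockUnion ((ℓ + 1) ^ k) R₀
  hsub : boxDom (fun i => (ℓ + 1) ^ k * M i) ⊆ R₀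
  /-- the mass `m² ∈ [0, m²₊]` -/
  m2 : ℝ
  hm : 0 ≤ m2
  hm' : m2 ≤ m2plus
  /-- the charge (inert at `A = 0`) -/
  e : ℝ

namespace BoxInst

variable {ℓ : ℕ} {m2plus : ℝ}

/-- `1 ≤ L^k`. [folklore] -/
theorem one_le_Lk (ℓ k : ℕ) : 1 ≤ (ℓ + 1) ^ k := Nat.one_le_pow _ _ (Nat.succ_pos ℓ)

/-- the member as one of b04's zero-field instances: `n = L^k`, `R = boxDom (L^k·M)`, `R₀`, `m²`, `e`. [folklore] -/
def toZF (i : BoxInst d ℓ m2plus) : ZeroFieldInstance d where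
  n := (ℓ + 1) ^ i.k
  hn := one_le_Lk ℓ i.k
  R := boxDom (fun j => (ℓ + 1) ^ i.k * i.M j)
  R₀ := i.R₀
  hR := boxDom_isBlockUnion (one_le_Lk ℓ i.k) i.M
  hR₀ := i.hR₀
  hsub := i.hsub
  m2 := i.m2
  hm := i.hm
  e := i.e

/-- the mesh denominator of the member. [folklore] -/
theorem toZF_n (i : BoxInst d ℓ m2plus) : i.toZF.n = (ℓ + 1) ^ i.k := rfl

/-- the fine region of the member is the box. [folklore] -/
theorem toZF_R (i : BoxInst d ℓ m2plus) : i.toZF.R = boxDom (fun j => (ℓ + 1) ^ i.k * i.M j) := rfl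

/-- **`G_k(Ω, 0)` of the member IS the lineage's box Green's function** `(boxOpR L^k a m² M)⁻¹`
(`B4Lower18.fineOpR_boxDom`). [folklore] -/
theorem green_eq (a : ℝ) (i : BoxInst d ℓ m2plus) :
    i.toZF.green a = (boxOpR ((ℓ + 1) ^ i.k) a i.m2 i.M)⁻¹ := by
  show (fineOpR ((ℓ + 1) ^ i.k) a i.m2 (boxDom (fun j => (ℓ + 1) ^ i.k * i.M j)))⁻¹ = _
  rw [fineOpR_boxDom]

/-- the box is a rectangular parallelepiped (`rect` holds for every member, so the typed antecedent
`rect ∨ R₀ ≤ dist(·, Ωᶜ)` of `Ineq19_110` is met everywhere: «for rectangular parallelepipeds, the inequalities hold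
without any restrictions on the points x, x′»). [cite: Balaban1983RegularityDecay, Theorem p.573, last sentence] -/
theorem rect (a : ℝ) (Mb : ℕ) (g : ∀ i : ZeroFieldInstance d, (↥i.R → ℝ) → ℝ) (i : BoxInst d ℓ m2plus) :
    (zeroFieldSettingBond a Mb g i.toZF).rect := by
  refine ⟨fun _ => 0, fun j => (((ℓ + 1) ^ i.k * i.M j : ℕ) : ℤ) - 1, fun x => ?_⟩
  show x ∈ boxDom (fun j => (ℓ + 1) ^ i.k * i.M j) ↔ _
  rw [mem_boxDom]
  refine forall_congr' fun j => ?_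
  rw [Int.le_sub_one_iff]

end BoxInst

/-- **THE ZERO-FIELD BOX FAMILY** in the cell's carrier: member `i ↦ zeroFieldSettingBond a Mb g (i.toZF)` (fixed `d`,
`L = ℓ+1`, coefficient `a` of `aP_k`, mass window `[0, m²₊]`, big-block size `Mb` of the typed antecedent `bigBlocks`,
boundary-distance assignment `g`). [cite: Balaban1983RegularityDecay, §1 pp. 572–573, case A = 0] -/
def boxFam (ℓ : ℕ) (m2plus a : ℝ) (Mb : ℕ) (g : ∀ i : ZeroFieldInstance d, (↥i.R → ℝ) → ℝ) :
    BoxInst d ℓ m2plus → EtaSetting :=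
  fun i => zeroFieldSettingBond a Mb g i.toZF

/-- the same family in b04's verbatim carrier (for the (1.10) clauses, which read identical fields). [folklore] -/
def boxFamB (ℓ : ℕ) (m2plus a : ℝ) (Mb : ℕ) (g : ∀ i : ZeroFieldInstance d, (↥i.R → ℝ) → ℝ) :
    BoxInst d ℓ m2plus → EtaSetting :=
  fun i => zeroFieldSettingB a Mb g i.toZF

/-! ## §3 Dictionary lemmas: distances, sources, derivatives -/

section Dictionary

variable {ℓ : ℕ} {m2plus : ℝ}

/-- `0 < L^k` as a real number. [folklore] -/
theorem Lk_pos (ℓ k : ℕ) : (0 : ℝ) < (((ℓ + 1) ^ k : ℕ) : ℝ) := by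
  exact_mod_cast Nat.pos_of_ne_zero (by positivity)

/-- `η|x − z|_∞·L^k = |x − z|_∞`: the distance hypothesis of the lineage's theorems from the carrier's set distance
to the support, single point. [folklore] -/
theorem D1_le (i : BoxInst d ℓ m2plus) (f : ↥i.toZF.R → ℝ) (x z : ↥i.toZF.R) (hz : f z ≠ 0) :
    (((ℓ + 1) ^ i.k : ℕ) : ℝ) * setDist (edistR i.toZF.n i.toZF.R) {x} (supp f) ≤ supNorm (x.1 - z.1) := by
  have h := setDist_le (edistR i.toZF.n i.toZF.R) (Finset.mem_singleton_self x) (mem_supp.2 hz)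
  have hn := Lk_pos ℓ i.k
  unfold edistR at h
  rw [BoxInst.toZF_n] at h
  calc (((ℓ + 1) ^ i.k : ℕ) : ℝ) * setDist (edistR i.toZF.n i.toZF.R) {x} (supp f)
      ≤ (((ℓ + 1) ^ i.k : ℕ) : ℝ) * (1 / (((ℓ + 1) ^ i.k : ℕ) : ℝ) * supNorm (x.1 - z.1)) :=
        mul_le_mul_of_nonneg_left h hn.le
    _ = supNorm (x.1 - z.1) := by field_simp

/-- the same for the pair `{x, x′}`. [folklore] -/
theorem D2_le (i : BoxInst d ℓ m2plus) (f : ↥i.toZF.R → ℝ) (x x' z : ↥i.toZF.R) (hz : f z ≠ 0) :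
    (((ℓ + 1) ^ i.k : ℕ) : ℝ) * setDist (edistR i.toZF.n i.toZF.R) ({x} ∪ {x'}) (supp f)
      ≤ min (supNorm (x.1 - z.1)) (supNorm (x'.1 - z.1)) := by
  have hn := Lk_pos ℓ i.k
  have key : ∀ y : ↥i.toZF.R, y ∈ ({x} ∪ {x'} : Finset ↥i.toZF.R) →
      (((ℓ + 1) ^ i.k : ℕ) : ℝ) * setDist (edistR i.toZF.n i.toZF.R) ({x} ∪ {x'}) (supp f)
        ≤ supNorm (y.1 - z.1) := by
    intro y hy
    have h := setDist_le (edistR i.toZF.n i.toZF.R) hy (mem_supp.2 hz)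
    unfold edistR at h
    rw [BoxInst.toZF_n] at h
    calc (((ℓ + 1) ^ i.k : ℕ) : ℝ) * setDist (edistR i.toZF.n i.toZF.R) ({x} ∪ {x'}) (supp f)
        ≤ (((ℓ + 1) ^ i.k : ℕ) : ℝ) * (1 / (((ℓ + 1) ^ i.k : ℕ) : ℝ) * supNorm (y.1 - z.1)) :=
          mul_le_mul_of_nonneg_left h hn.le
      _ = supNorm (y.1 - z.1) := by field_simp
  exact le_min (key x (by simp)) (key x' (by simp))

/-- the exponent bookkeeping `δ·(L^k·s)/L^k = δ·s`. [folklore] -/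
theorem exp_arg (ℓ k : ℕ) (δ s : ℝ) :
    δ * ((((ℓ + 1) ^ k : ℕ) : ℝ) * s) / (((ℓ + 1) ^ k : ℕ) : ℝ) = δ * s := by
  have hn := (Lk_pos ℓ k).ne'
  field_simp

/-- **MONOTONICITY OF THE PRINTED BOUND IN THE CONSTANTS** together with the exponent bookkeeping: from the
lineage's `c·e^{−δD/L^k}·F` with `D = L^k·s` to the carrier's `c′·e^{−δ′s}·F` for `c ≤ c′`, `δ′ ≤ δ`. [folklore] -/
theorem transfer {ℓ k : ℕ} {P c c' δ δ' s F : ℝ} (hc : c ≤ c') (hδ : δ' ≤ δ) (hc0 : 0 ≤ c) (hs : 0 ≤ s)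
    (hF : 0 ≤ F)
    (h : P ≤ c * Real.exp (-(δ * ((((ℓ + 1) ^ k : ℕ) : ℝ) * s) / (((ℓ + 1) ^ k : ℕ) : ℝ))) * F) :
    P ≤ c' * Real.exp (-(δ' * s)) * F := by
  rw [exp_arg] at h
  refine h.trans ?_
  have he : Real.exp (-(δ * s)) ≤ Real.exp (-(δ' * s)) :=
    Real.exp_le_exp.2 (by nlinarith [mul_le_mul_of_nonneg_right hδ hs])
  exact mul_le_mul_of_nonneg_right (mul_le_mul hc he (Real.exp_pos _).le (hc0.trans hc)) hF

/-- the set distance along `edistR` is `≥ 0`. [folklore] -/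
theorem setDist_edistR_nonneg {n : ℕ} {R : Finset (Fin (d + 1) → ℤ)} (A B : Finset ↥R) :
    0 ≤ setDist (edistR n R) A B := by
  unfold setDist
  split_ifs with h
  · exact Finset.le_inf' _ _ fun p _ => B4Cor23Zero.edistR_nonneg _ _
  · exact le_rfl

/-- the forward `μ`-neighbour inside the box, as a point of the box. [folklore] -/
def nbr {R : Finset (Fin (d + 1) → ℤ)} {μ : Fin (d + 1)} (x : ↥R) (h : x.1 + uvec μ ∈ R) : ↥R := ⟨x.1 + uvec μ, h⟩

/-- its coordinates are `x + e_μ` (the lineage's hypothesis shape `xe.1 = x.1 + Pi.single μ 1`). [folklore] -/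
theorem nbr_val {R : Finset (Fin (d + 1) → ℤ)} {μ : Fin (d + 1)} (x : ↥R) (h : x.1 + uvec μ ∈ R) :
    (nbr x h).1 = x.1 + Pi.single μ 1 := rfl

/-- `D_μψ(x) = L^k(ψ(x + e_μ) − ψ(x))` on a bond. [folklore] -/
theorem fdiff_eq {n : ℕ} {R : Finset (Fin (d + 1) → ℤ)} {μ : Fin (d + 1)} (ψ : ↥R → ℝ) (x : ↥R)
    (h : x.1 + uvec μ ∈ R) : fdiff n R μ ψ x = (n : ℝ) * (ψ (nbr x h) - ψ x) :=
  fdiff_of_mem ψ h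

/-- the Hölder weight of the carrier is the lineage's: `(η|x − x′|_∞)^{−α} = (L^k/|x′ − x|_∞)^α`. [folklore] -/
theorem edistR_rpow_neg {n : ℕ} {R : Finset (Fin (d + 1) → ℤ)} (α : ℝ) (x x' : ↥R) :
    edistR n R x x' ^ (-α) = ((n : ℝ) / supNorm (x'.1 - x.1)) ^ α := by
  unfold edistR
  rw [supNorm_sub_comm x.1 x'.1, Real.rpow_neg (mul_nonneg (by positivity) (supNorm_nonneg _)),
    ← Real.inv_rpow (mul_nonneg (by positivity) (supNorm_nonneg _)), mul_inv, one_div, inv_inv,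
    div_eq_mul_inv]

end Dictionary


/-! ## §4 The three clauses of (1.9)–(1.10) on every member, from the lineage's box theorems -/

section Clauses

variable {ℓ : ℕ} {m2plus : ℝ}

/-- a bound `0 ≤ c·e^{−δs}·‖f‖_∞`. [folklore] -/
theorem rhs_nonneg {c δ s : ℝ} (hc : 0 ≤ c) (i : ZeroFieldInstance d) (f : ↥i.R → ℝ) :
    0 ≤ c * Real.exp (-(δ * s)) * i.supN f :=
  mul_nonneg (mul_nonneg hc (Real.exp_pos _).le) (supN_nonneg i f)

/-- **CLAUSE (1.9) AT `A = 0` ON EVERY BOX, in the bond convention**, for `0 ≤ α < 1`, ONE pair `(δ₀, c₀)` for the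
whole family (fixed `d`, `L = ℓ+1 ≥ 2`, `a > 0`, `m²₊`; `c₀` depends on `α`): for every member (every scale `k ≥ 1`,
every box, every mass in the window), every direction `μ`, source `f` and points `x, x′` of the box,
`|x − x′|_η^{−α}|(D_μG_k(Ω,0)f)(x′) − (D_μG_k(Ω,0)f)(x)| ≤ c₀e^{−δ₀dist_η({x,x′}, supp f)}‖f‖_∞` (bonds of `Ω`; `0`
off bonds) — from `B4Thm19ZeroBoxHolder.thm19_zero_box_holder_value_coeff` (node 10) through the dictionary of §3.
[cite: Balaban1983RegularityDecay, Theorem p. 573 (1.9), case A = 0, Ω a box («rectangular parallelepipeds … for all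
x, x′ ∈ Ω»), 0 ≤ α < 1] -/
theorem lhs19_bound (hℓ : 1 ≤ ℓ) (a : ℝ) (ha : 0 < a) (α : ℝ) (hα0 : 0 ≤ α) (hα1 : α < 1) :
    ∃ δ₀ c₀ : ℝ, 0 < δ₀ ∧ 0 < c₀ ∧ ∀ (i : BoxInst d ℓ m2plus) (μ : Fin (d + 1)) (f : ↥i.toZF.R → ℝ)
      (x x' : ↥i.toZF.R),
      holderQ i.toZF.n i.toZF.R α μ ((i.toZF.green a).mulVec f) x x'
        ≤ c₀ * Real.exp (-(δ₀ * setDist (edistR i.toZF.n i.toZF.R) ({x} ∪ {x'}) (supp f))) * i.toZF.supN f := by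
  obtain ⟨δ₀, c₀, hδ, hc, h⟩ := thm19_zero_box_holder_value_coeff d ℓ hℓ a a m2plus ha α hα0 hα1
  refine ⟨δ₀, c₀, hδ, hc, fun i μ f x x' => ?_⟩
  have hF := supN_nonneg i.toZF f
  have hs := setDist_edistR_nonneg (n := i.toZF.n) ({x} ∪ {x'}) (supp f)
  have h0 := rhs_nonneg (δ := δ₀) (s := setDist (edistR i.toZF.n i.toZF.R) ({x} ∪ {x'}) (supp f)) hc.le i.toZF f
  by_cases hb : x.1 + uvec μ ∈ i.toZF.R ∧ x'.1 + uvec μ ∈ i.toZF.R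
  swap
  · rw [holderQ_of_not_bond α _ hb]
    exact h0
  obtain ⟨hx, hx'⟩ := hb
  rw [holderQ_of_bond α _ hx hx']
  by_cases hxx : x'.1 = x.1
  · have hx'x : x' = x := Subtype.ext hxx
    subst hx'x
    rw [sub_self, abs_zero, mul_zero]
    exact h0
  rw [edistR_rpow_neg, fdiff_eq _ x hx, fdiff_eq _ x' hx', BoxInst.green_eq]
  have key := h i.k i.hk a i.m2 le_rfl le_rfl i.hm i.hm' i.M i.hM f (i.toZF.supN f)
    ((((ℓ + 1) ^ i.k : ℕ) : ℝ) * setDist (edistR i.toZF.n i.toZF.R) ({x} ∪ {x'}) (supp f))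
    (fun z => abs_le_supN i.toZF f z) μ x (nbr x hx) x' (nbr x' hx') (nbr_val x hx) (nbr_val x' hx') hxx
    (fun z hz => D2_le i f x x' z hz)
  have e : ∀ (n p q r s : ℝ), n * (p - q) - n * (r - s) = n * ((p - q) - (r - s)) := fun n p q r s => by ring
  rw [e]
  exact transfer le_rfl le_rfl hc.le hs hF key

/-- **CLAUSE (1.10), DERIVATIVE, AT `A = 0` ON EVERY BOX**: ONE pair `(δ₀, c₀)` for the whole family such that
`|(D_μG_k(Ω,0)f)(x)| ≤ c₀e^{−δ₀dist_η(x, supp f)}‖f‖_∞` for every member, direction, source and point (`D_μ = 0` off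
bonds) — from `B4Thm110ZeroBoxDeriv.thm110_zero_box_deriv_value_coeff` (node 7).
[cite: Balaban1983RegularityDecay, Theorem p. 573 (1.10) first quantity, case A = 0, Ω a box] -/
theorem valDG_bound (hℓ : 1 ≤ ℓ) (a : ℝ) (ha : 0 < a) :
    ∃ δ₀ c₀ : ℝ, 0 < δ₀ ∧ 0 < c₀ ∧ ∀ (i : BoxInst d ℓ m2plus) (μ : Fin (d + 1)) (f : ↥i.toZF.R → ℝ)
      (x : ↥i.toZF.R),
      |fdiff i.toZF.n i.toZF.R μ ((i.toZF.green a).mulVec f) x|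
        ≤ c₀ * Real.exp (-(δ₀ * setDist (edistR i.toZF.n i.toZF.R) {x} (supp f))) * i.toZF.supN f := by
  obtain ⟨δ₀, c₀, hδ, hc, h⟩ := thm110_zero_box_deriv_value_coeff d ℓ hℓ a a m2plus ha
  refine ⟨δ₀, c₀, hδ, hc, fun i μ f x => ?_⟩
  have hF := supN_nonneg i.toZF f
  have hs := setDist_edistR_nonneg (n := i.toZF.n) {x} (supp f)
  have h0 := rhs_nonneg (δ := δ₀) (s := setDist (edistR i.toZF.n i.toZF.R) {x} (supp f)) hc.le i.toZF f
  by_cases hx : x.1 + uvec μ ∈ i.toZF.R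
  swap
  · rw [fdiff_of_not_mem _ hx, abs_zero]
    exact h0
  rw [fdiff_eq _ x hx, BoxInst.green_eq]
  have key := h i.k i.hk a i.m2 le_rfl le_rfl i.hm i.hm' i.M i.hM f (i.toZF.supN f)
    ((((ℓ + 1) ^ i.k : ℕ) : ℝ) * setDist (edistR i.toZF.n i.toZF.R) {x} (supp f))
    (fun z => abs_le_supN i.toZF f z) μ x (nbr x hx) (nbr_val x hx) (fun z hz => D1_le i f x z hz)
  exact transfer le_rfl le_rfl hc.le hs hF key

/-- **CLAUSE (1.10), VALUE, AT `A = 0` ON EVERY BOX**: ONE pair `(δ₀, c₀)` for the whole family such that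
`|(G_k(Ω,0)f)(x)| ≤ c₀e^{−δ₀dist_η(x, supp f)}‖f‖_∞` — from `B4Thm110ZeroBox.thm110_zero_box_value_coeff` (node 6).
[cite: Balaban1983RegularityDecay, Theorem p. 573 (1.10) second quantity, case A = 0, Ω a box] -/
theorem valG_bound (hℓ : 1 ≤ ℓ) (a : ℝ) (ha : 0 < a) :
    ∃ δ₀ c₀ : ℝ, 0 < δ₀ ∧ 0 < c₀ ∧ ∀ (i : BoxInst d ℓ m2plus) (f : ↥i.toZF.R → ℝ) (x : ↥i.toZF.R),
      |((i.toZF.green a).mulVec f) x|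
        ≤ c₀ * Real.exp (-(δ₀ * setDist (edistR i.toZF.n i.toZF.R) {x} (supp f))) * i.toZF.supN f := by
  obtain ⟨δ₀, c₀, hδ, hc, h⟩ := thm110_zero_box_value_coeff d ℓ hℓ a a m2plus ha
  refine ⟨δ₀, c₀, hδ, hc, fun i f x => ?_⟩
  have hF := supN_nonneg i.toZF f
  have hs := setDist_edistR_nonneg (n := i.toZF.n) {x} (supp f)
  rw [BoxInst.green_eq]
  have key := h i.k i.hk a i.m2 le_rfl le_rfl i.hm i.hm' i.M i.hM f (i.toZF.supN f)
    ((((ℓ + 1) ^ i.k : ℕ) : ℝ) * setDist (edistR i.toZF.n i.toZF.R) {x} (supp f))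
    (fun z => abs_le_supN i.toZF f z) x (fun z hz => D1_le i f x z hz)
  exact transfer le_rfl le_rfl hc.le hs hF key

end Clauses

/-! ## §5 `B4.Ineq19_110` on the box family -/

section Main

variable {ℓ : ℕ} {m2plus : ℝ}

/-- **B4's THEOREM p. 573, CLAUSES (1.9)–(1.10) — the cell's typed `B4.Ineq19_110` — AT `A = 0` ON THE ZERO-FIELD BOX
FAMILY**, for every `0 ≤ α < 1`: there is ONE pair of positive constants `(δ₀, c₀)` (depending on `d`, `L`, `a`, `m²₊`
and `α` — «independent of A, k, Ω», here: of the member) such that for EVERY threshold `R₀` and EVERY member `i` the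
typed statement `Ineq19_110 (boxFam … i) α δ₀ c₀ R₀` holds (its antecedent `rect ∨ R₀ ≤ dist(·,Ωᶜ)` is not used: on a
box the inequalities hold «for all x, x′ ∈ Ω»).  Assembled from §4.
[cite: Balaban1983RegularityDecay, Theorem p. 573 (1.9)–(1.10), case A = 0, Ω a box, 0 ≤ α < 1] -/
theorem ineq19_110_boxFam (hℓ : 1 ≤ ℓ) (a : ℝ) (ha : 0 < a) (Mb : ℕ)
    (g : ∀ i : ZeroFieldInstance d, (↥i.R → ℝ) → ℝ) (α : ℝ) (hα0 : 0 ≤ α) (hα1 : α < 1) :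
    ∃ δ₀ c₀ : ℝ, 0 < δ₀ ∧ 0 < c₀ ∧ ∀ (R₀ : ℝ) (i : BoxInst d ℓ m2plus),
      Ineq19_110 (boxFam ℓ m2plus a Mb g i) α δ₀ c₀ R₀ := by
  obtain ⟨δ₁, c₁, hδ₁, hc₁, h₁⟩ := lhs19_bound (m2plus := m2plus) hℓ a ha α hα0 hα1
  obtain ⟨δ₂, c₂, hδ₂, hc₂, h₂⟩ := valDG_bound (d := d) (m2plus := m2plus) hℓ a ha
  obtain ⟨δ₃, c₃, hδ₃, hc₃, h₃⟩ := valG_bound (d := d) (m2plus := m2plus) hℓ a ha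
  refine ⟨min δ₁ (min δ₂ δ₃), max c₁ (max c₂ c₃), lt_min hδ₁ (lt_min hδ₂ hδ₃),
    lt_max_of_lt_left hc₁, fun R₀ i => (ineq19_110_bond_iff a Mb g i.toZF _ _ _ _).2
      ⟨fun μ f x x' _ => ?_, fun μ f x _ => ⟨?_, ?_⟩⟩⟩
  · have hF := supN_nonneg i.toZF f
    have hs := setDist_edistR_nonneg (n := i.toZF.n) ({x} ∪ {x'}) (supp f)
    refine (h₁ i μ f x x').trans ?_
    have he : Real.exp (-(δ₁ * setDist (edistR i.toZF.n i.toZF.R) ({x} ∪ {x'}) (supp f)))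
        ≤ Real.exp (-(min δ₁ (min δ₂ δ₃) * setDist (edistR i.toZF.n i.toZF.R) ({x} ∪ {x'}) (supp f))) :=
      Real.exp_le_exp.2 (by nlinarith [mul_le_mul_of_nonneg_right (min_le_left δ₁ (min δ₂ δ₃)) hs])
    exact mul_le_mul_of_nonneg_right
      (mul_le_mul (le_max_left _ _) he (Real.exp_pos _).le (hc₁.le.trans (le_max_left _ _))) hF
  · have hF := supN_nonneg i.toZF f
    have hs := setDist_edistR_nonneg (n := i.toZF.n) {x} (supp f)
    refine (h₂ i μ f x).trans ?_
    have hδ : min δ₁ (min δ₂ δ₃) ≤ δ₂ := (min_le_right _ _).trans (min_le_left _ _)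
    have hc : c₂ ≤ max c₁ (max c₂ c₃) := (le_max_left _ _).trans (le_max_right _ _)
    have he : Real.exp (-(δ₂ * setDist (edistR i.toZF.n i.toZF.R) {x} (supp f)))
        ≤ Real.exp (-(min δ₁ (min δ₂ δ₃) * setDist (edistR i.toZF.n i.toZF.R) {x} (supp f))) :=
      Real.exp_le_exp.2 (by nlinarith [mul_le_mul_of_nonneg_right hδ hs])
    exact mul_le_mul_of_nonneg_right (mul_le_mul hc he (Real.exp_pos _).le (hc₂.le.trans hc)) hF
  · have hF := supN_nonneg i.toZF f
    have hs := setDist_edistR_nonneg (n := i.toZF.n) {x} (supp f)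
    refine (h₃ i f x).trans ?_
    have hδ : min δ₁ (min δ₂ δ₃) ≤ δ₃ := (min_le_right _ _).trans (min_le_right _ _)
    have hc : c₃ ≤ max c₁ (max c₂ c₃) := (le_max_right _ _).trans (le_max_right _ _)
    have he : Real.exp (-(δ₃ * setDist (edistR i.toZF.n i.toZF.R) {x} (supp f)))
        ≤ Real.exp (-(min δ₁ (min δ₂ δ₃) * setDist (edistR i.toZF.n i.toZF.R) {x} (supp f))) :=
      Real.exp_le_exp.2 (by nlinarith [mul_le_mul_of_nonneg_right hδ hs])
    exact mul_le_mul_of_nonneg_right (mul_le_mul hc he (Real.exp_pos _).le (hc₃.le.trans hc)) hF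

/-- **THE (1.10) CLAUSES ALSO HOLD VERBATIM IN b04's CARRIER** `zeroFieldSettingB` (same fields): ONE pair
`(δ₀, c₀)` (no `α`) such that for every threshold `R₀`, member `i`, direction, source and point, the second conjunct
of `Ineq19_110 (boxFamB … i) α δ₀ c₀ R₀` holds (for any `α`: it does not mention `α`).
[cite: Balaban1983RegularityDecay, Theorem p. 573 (1.10), case A = 0, Ω a box] -/
theorem ineq110_boxFamB (hℓ : 1 ≤ ℓ) (a : ℝ) (ha : 0 < a) (Mb : ℕ)
    (g : ∀ i : ZeroFieldInstance d, (↥i.R → ℝ) → ℝ) :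
    ∃ δ₀ c₀ : ℝ, 0 < δ₀ ∧ 0 < c₀ ∧ ∀ (R₀ : ℝ) (i : BoxInst d ℓ m2plus)
      (μ : (boxFamB ℓ m2plus a Mb g i).Dir) (f : (boxFamB ℓ m2plus a Mb g i).Src)
      (x : (boxFamB ℓ m2plus a Mb g i).Site),
      ((boxFamB ℓ m2plus a Mb g i).rect ∨ R₀ ≤ (boxFamB ℓ m2plus a Mb g i).bdist1 x) →
        (boxFamB ℓ m2plus a Mb g i).valDG μ f x ≤
            c₀ * Real.exp (-(δ₀ * (boxFamB ℓ m2plus a Mb g i).sdist1 x f)) *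
              (boxFamB ℓ m2plus a Mb g i).supNorm f ∧
          (boxFamB ℓ m2plus a Mb g i).valG f x ≤
            c₀ * Real.exp (-(δ₀ * (boxFamB ℓ m2plus a Mb g i).sdist1 x f)) *
              (boxFamB ℓ m2plus a Mb g i).supNorm f := by
  obtain ⟨δ₀, c₀, hδ, hc, h⟩ := ineq19_110_boxFam (m2plus := m2plus) hℓ a ha Mb g 0 le_rfl one_pos
  exact ⟨δ₀, c₀, hδ, hc, fun R₀ i => ((ineq19_110_bond_iff a Mb g i.toZF 0 δ₀ c₀ R₀).1 (h R₀ i)).2⟩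

end Main

/-! ## §6 The leaf shape: `ThmPrinted` restricted to (1.9)–(1.10) and to `0 ≤ α < 1` -/

section Leaf

variable {I : Type}

/-- **THE (1.9)–(1.10) HALF OF THE TYPED LEAF `B4.ThmPrinted`, FOR `0 ≤ α < 1`** (verbatim the leaf's quantifier
shape — «there exist positive constants δ₀, c₀, R₀ … such that for e sufficiently small» — with the conclusion
`Ineq19_110` only and the Hölder exponent restricted to `0 ≤ α`; see the module docstring, OBSERVATION (O-α), for why
the typed leaf's `α < 0` instances are not the printed theorem's content). [cite: Balaban1983RegularityDecay, Theorem
p. 573 (1.9)–(1.10), transcription of the typed leaf `B4.ThmPrinted` restricted] -/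
def ThmPrinted19NN (fam : I → EtaSetting) : Prop :=
  ∀ α : ℝ, 0 ≤ α → α < 1 → ∃ δ₀ c₀ R₀ e₁ : ℝ, 0 < δ₀ ∧ 0 < c₀ ∧ 0 < R₀ ∧ 0 < e₁ ∧ ∀ i : I,
    (fam i).regular → (fam i).bigBlocks → 0 < (fam i).e → (fam i).e ≤ e₁ → Ineq19_110 (fam i) α δ₀ c₀ R₀

/-- the typed leaf implies its (1.9)–(1.10), `0 ≤ α` half (so `ThmPrinted19NN` IS a weakening of the cell's leaf, not
a new statement). [folklore] -/
theorem thmPrinted19NN_of_thmPrinted (fam : I → EtaSetting) (h : ThmPrinted fam) : ThmPrinted19NN fam := by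
  intro α _ hα1
  obtain ⟨δ₀, c₀, R₀, e₁, hδ, hc, hR, he, H⟩ := h α hα1
  exact ⟨δ₀, c₀, R₀, e₁, hδ, hc, hR, he, fun i h1 h2 h3 h4 => (H i h1 h2 h3 h4).1⟩

variable {ℓ : ℕ} {m2plus : ℝ}

/-- **THE LEAF HALF `ThmPrinted19NN` HOLDS ON THE ZERO-FIELD BOX FAMILY** (every `L = ℓ + 1 ≥ 2`, `a > 0`, mass
window `[0, m²₊]`, big-block size `Mb`, boundary assignment `g`): unconditionally in the member — the typed
antecedents `regular`, `bigBlocks`, `0 < e ≤ e₁` are not used (at `A = 0` the field is regular and the charge inert),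
and `R₀`, `e₁` are witnessed by `1`. [cite: Balaban1983RegularityDecay, Theorem p. 573 (1.9)–(1.10), case A = 0,
Ω a box, 0 ≤ α < 1] -/
theorem thmPrinted19NN_boxFam (hℓ : 1 ≤ ℓ) (a : ℝ) (ha : 0 < a) (Mb : ℕ)
    (g : ∀ i : ZeroFieldInstance d, (↥i.R → ℝ) → ℝ) :
    ThmPrinted19NN (boxFam (d := d) ℓ m2plus a Mb g) := by
  intro α hα0 hα1
  obtain ⟨δ₀, c₀, hδ, hc, h⟩ := ineq19_110_boxFam (m2plus := m2plus) hℓ a ha Mb g α hα0 hα1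
  exact ⟨δ₀, c₀, 1, 1, hδ, hc, one_pos, one_pos, fun i _ _ _ _ => h 1 i⟩

/-- the same for the default boundary assignment (`boxFam … (fun i f => bdist …)`, b04's `zeroFieldSetting` re-read).
[folklore] -/
theorem thmPrinted19NN_boxFam_std (hℓ : 1 ≤ ℓ) (a : ℝ) (ha : 0 < a) (Mb : ℕ) :
    ThmPrinted19NN (fun i : BoxInst d ℓ m2plus => zeroFieldSettingBondStd a Mb i.toZF) :=
  thmPrinted19NN_boxFam hℓ a ha Mb _

end Leaf

/-! ## §7 Non-vacuity: the typed antecedents are met at every scale; the index type is inhabited -/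

section NonVacuity

variable {ℓ : ℕ} {m2plus : ℝ}

/-- the member «scale `k`, the cube `[0, Mb)^{d+1}` of ONE big block, `Ω₀ = Ω`, mass `0`, charge `e`». [folklore] -/
def BoxInst.cube (ℓ : ℕ) {m2plus : ℝ} (hm2 : 0 ≤ m2plus) (k : ℕ) (hk : 1 ≤ k) (Mb : ℕ) (hMb : 1 ≤ Mb) (e : ℝ) :
    BoxInst d ℓ m2plus where
  k := k
  hk := hk
  M := fun _ => Mb
  hM := fun _ => hMb
  R₀ := boxDom (fun _ : Fin (d + 1) => (ℓ + 1) ^ k * Mb)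
  hR₀ := boxDom_isBlockUnion (BoxInst.one_le_Lk ℓ k) (fun _ => Mb)
  hsub := Finset.Subset.refl _
  m2 := 0
  hm := le_rfl
  hm' := hm2
  e := e

/-- NON-VACUITY AT EVERY SCALE: for every `e₁ > 0`, every big-block size `Mb ≥ 1` and every `k ≥ 1` the member
`cube … k … Mb … e₁` meets ALL FOUR typed antecedents of the leaf (`regular`, `bigBlocks`, `0 < e ≤ e₁`), so the
threshold «for e sufficiently small» and the big-block hypothesis exclude no mesh `η = L^{-k}` — the uniformity in `k`
certified by `ineq19_110_boxFam` is exercised. [folklore] -/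
theorem cube_hypotheses (hm2 : 0 ≤ m2plus) (a : ℝ) (g : ∀ i : ZeroFieldInstance d, (↥i.R → ℝ) → ℝ) (k : ℕ)
    (hk : 1 ≤ k) (Mb : ℕ) (hMb : 1 ≤ Mb) {e₁ : ℝ} (he : 0 < e₁) :
    (boxFam ℓ m2plus a Mb g (BoxInst.cube ℓ hm2 k hk Mb hMb e₁)).regular ∧
      (boxFam ℓ m2plus a Mb g (BoxInst.cube ℓ hm2 k hk Mb hMb e₁)).bigBlocks ∧
      0 < (boxFam ℓ m2plus a Mb g (BoxInst.cube ℓ hm2 k hk Mb hMb e₁)).e ∧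
      (boxFam ℓ m2plus a Mb g (BoxInst.cube ℓ hm2 k hk Mb hMb e₁)).e ≤ e₁ := by
  have hMn : 1 ≤ Mb * (ℓ + 1) ^ k :=
    Nat.one_le_iff_ne_zero.mpr (Nat.mul_ne_zero (by omega) (Nat.pos_iff_ne_zero.mp (Nat.pos_of_ne_zero (by positivity))))
  have h := boxDom_isBlockUnion (d := d) hMn fun _ => 1
  have e : (fun _ : Fin (d + 1) => Mb * (ℓ + 1) ^ k * 1) = fun _ : Fin (d + 1) => (ℓ + 1) ^ k * Mb := by
    funext; ring
  rw [e] at h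
  exact ⟨trivial, ⟨h, h⟩, he, le_rfl⟩

/-- hence, for every threshold `e₁ > 0` and every scale, SOME member meets the antecedents (pattern of
`B4Cor23ZeroEta.threshold_met`). [folklore] -/
theorem threshold_met (hm2 : 0 ≤ m2plus) (a : ℝ) (g : ∀ i : ZeroFieldInstance d, (↥i.R → ℝ) → ℝ) {Mb : ℕ}
    (hMb : 1 ≤ Mb) (k : ℕ) (hk : 1 ≤ k) {e₁ : ℝ} (he : 0 < e₁) :
    ∃ i : BoxInst d ℓ m2plus, i.k = k ∧ (boxFam ℓ m2plus a Mb g i).regular ∧ (boxFam ℓ m2plus a Mb g i).bigBlocks ∧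
      0 < (boxFam ℓ m2plus a Mb g i).e ∧ (boxFam ℓ m2plus a Mb g i).e ≤ e₁ :=
  ⟨BoxInst.cube ℓ hm2 k hk Mb hMb e₁, rfl, cube_hypotheses hm2 a g k hk Mb hMb he⟩

/-- the index type is inhabited: `d + 1 = 4`, `L = 2`, `m²₊ = 1`, scale `k = 3` (`η = 1/8`), the cube of one big block
of size `5`, charge `1`. [folklore] -/
example : BoxInst 3 1 1 := BoxInst.cube 1 zero_le_one 3 (by norm_num) 5 (by norm_num) 1

/-- and the certified statement is instantiated: `d + 1 = 4`, `L = 2`, `a = 1`, `m²₊ = 1`, `Mb = 5`, default `g`,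
`α = 1/2`. [folklore] -/
example : ∃ δ₀ c₀ : ℝ, 0 < δ₀ ∧ 0 < c₀ ∧ ∀ (R₀ : ℝ) (i : BoxInst 3 1 1),
    Ineq19_110 (boxFam 1 1 1 5 (fun i f => B4Cor23ZeroDelta.bdist i.n i.hsub f) i) (1 / 2) δ₀ c₀ R₀ :=
  ineq19_110_boxFam le_rfl 1 one_pos 5 _ (1 / 2) (by norm_num) (by norm_num)

/-- the leaf half on the default family at `d + 1 = 4`, `L = 2`, `a = 1`, `m²₊ = 1`, `Mb = 5`. [folklore] -/
example : ThmPrinted19NN (fun i : BoxInst 3 1 1 => zeroFieldSettingBondStd 1 5 i.toZF) :=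
  thmPrinted19NN_boxFam_std le_rfl 1 one_pos 5

end NonVacuity

end

end Literature.MathematicalPhysics.QuantumFieldTheory.Balaban1983to89.B4Ineq19ZeroBoxEta
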